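import Summits.BirchSwinnertonDyer.Rank1Residual.X2.NonsplitBDPExists
import Summits.BirchSwinnertonDyer.Rank1Residual.X1.UnrSeriesFirstUnitCoeff
import HarnessLib

/-!
# O9 ∩ {non-split}: the hard half H3 = c3 `NonsplitIMCEqOnTree` SPLIT BY PROVENANCE — ONE
# DIVISIBILITY (R-β: Kolyvagin at `p ‖ N`) + `μ = 0` AND `λ`-EQUALITY (Keller–Yin D′), composed in the
# kernel (cell `bsd-eis`, seat `bsd-eis-cgshw` g4; route `EisensteinPrimes`, crux 4 `BSDpOnCellC`,
# line L4-b1, reshape of stub c3; cgshw MEMO-5 Add. v1.2 "Equality ⟸ Kolyvagin divisibility + D′",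
# MEMO-6 K2/K6)

HONEST FRAMING (cell `bsd-eis`): theorems + two hypothesis-shaped `@[conjecture]` predicates; nothing
booked; X2 stays CONSTRUCTION-SHAPED; no label moves. The (b1) road's open half H3 is
`X2.NonsplitIMCEqOnTree W p` (`X2/NonsplitBDPExists.lean`, p404147): at every non-split X2c Heegner
datum and every BDP frame `L ∈ R₀⟦T⟧`, `Ch_Λ(X_ac^∅(E[p^∞]))·R₀⟦T⟧ = (L)` — Keller–Yin Thm. D shape
(arXiv:2402.12781v2 Thm. 5.1.3; PREPRINT; the text proves D′ = "μ(𝔛_f) = μ(𝓛_f) = 0,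
λ(𝔛_f) = λ(𝓛_f)" — bsd-eis-ky MEMO-2, referee PASS — and the characteristic-ideal form needs one
more input: (α), or the reverse route R-β of cgshw MEMO-5 Add. v1.2–1.4 / MEMO-6). This file TYPES
that decomposition on the tree's objects, exactly as the sister seat did for the good anomalous
lattice (`X1/KellerYinIMC2Halves.lean`, p407283: L-div + L-μλ ⟹ IMC2):

* `NonsplitKolyvaginDivOnTree W p` (c3-div) — **ONE DIVISIBILITY after inverting `p`**: for some
  `k`, `p^k·L ∈ Ch_Λ(X_ac^∅)·R₀⟦T⟧` ("`(L_𝔭(f)) ⊆ char_Λ(X_𝔭)·Λ_{R₀}` up to `p`-power"). PRINT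
  (R-β): the reducible Heegner-point Kolyvagin system at `p ‖ N` (CGLS 2022 Thm. 4.1.1 transposed —
  bookkeeping K1–K6 at memo level: MEMO-5 Add. v1.3/v1.4, MEMO-6: BD96 (7)–(8) regularisation with
  Kolyvagin conductor, `Φ_p = 1 − a_p⁻¹σ_𝔭`, `κ₁ ≠ 0` by Gross–Zagier in rank 1) + CGS 2025
  Thm. 5.5.1 (abstract Λ-adic Kolyvagin bound, PUB) + Castella arXiv:2409.01360 Cor. 2.3 + Prop. 3.2
  (Λ⁻-adic Heegner reciprocity law at a NON-split `p ‖ N` and the PT-equivalence; PREPRINT,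
  image-free as stated). NOT in print as one statement; TYPED, not attempted.
* `NonsplitMuLambdaOnTree W p` (c3-μλ) — **Keller–Yin D′**: for every generator `𝓕` of `Ch_Λ(X_ac^∅)`
  the first unit coefficient of `𝓕` (read in `R₀ ⊇ ℤ_p`) and of `L` sit at the same index `n`
  (`μ = 0` on both sides and `λ(𝓕) = λ(L) = n`; Weierstrass preparation over `ℤ_p`, `R₀`) — KY v2
  Thm. 5.1.3's text (P1–P6 of ky MEMO-2: `μ(𝓛_f) = 0` by Hsieh/Hida + the free-part λ-count),
  PREPRINT, referee-read ("what KY's text proves"). NEVER cite as a theorem.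
* `nonsplitIMCEqOnTree_of_div_of_muLambda : c3-div → c3-μλ → NonsplitIMCEqOnTree W p` — the
  sister seat's `R₀⟦T⟧` algebra `X1.KellerYinHalves.span_singleton_eq_of_C_pow_mul_mem`
  ("`p^k·L ∈ (𝓕)`, `μ = 0` on both, equal `λ` ⟹ `(𝓕) = (L)`", p406792) and the principality of
  characteristic ideals (`charIdeal_isPrincipal_holds`).

So stub c3 of line L4-b1 reshapes into two stubs with DISJOINT provenance: c3-div (Castella 2024 PRE +
reducible Heegner KS assembly + CGS 5.5.1) and c3-μλ (KY D′, PRE-proved per the cell's referee).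
CONDITIONAL; nothing booked; no label change.

References: [KellerYin2024] Thm. D = v2 Thm. 5.1.3 (PRE); [Castella2024] = arXiv:2409.01360
Cor. 2.3, Prop. 3.2 (PRE); [CastellaGrossiSkinner2025] Thm. 5.5.1; [CastellaGrossiLeeSkinner2022]
Thm. 4.1.1; [BertoliniDarmon1996] §2.4–2.5; [Washington1997] §7.1, §13.2.
-/

set_option autoImplicit false

noncomputable section

open scoped Classical MatrixGroups ModularForm

open CongruenceSubgroup WeierstrassCurve NumberField IsDedekindDomain Field PowerSeries
  Literature.NumberTheory.EllipticCurves Literature.NumberTheory.EllipticCurves.GreenbergSelmer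
  Literature.NumberTheory.EllipticCurves.ModularForms
  Literature.NumberTheory.EllipticCurves.Rank1Residual
  Literature.NumberTheory.EllipticCurves.Rank1Residual.Typed
  Literature.NumberTheory.GaloisRepresentations Literature.NumberTheory.GaloisCohomology
  Literature.NumberTheory.Automorphic
  Summit.BirchSwinnertonDyer.Rank1Residual.X11b.AcSelmer
  Summit.BirchSwinnertonDyer.Rank1Residual.X11b.Halves
  Summit.BirchSwinnertonDyer.Rank1Residual.X11b
  Summit.BirchSwinnertonDyer.Rank1Residual.X1.KellerYinHalves

namespace Summit.BirchSwinnertonDyer.Rank1Residual.X2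

section Halves

variable (W : WeierstrassCurve ℚ) [W.IsElliptic] [W.IsGloballyMinimal] (p : ℕ) [Fact p.Prime]

/-- **c3-div — ONE DIVISIBILITY in the anticyclotomic IMC at a NON-split Eisenstein `p ‖ N`, after
inverting `p`**, on the data of `NonsplitIMCEqOnTree` (a non-split X2c pair, a Heegner datum with
`p ∤ c` and non-torsion point, an anticyclotomic `κ` with generator `γ`, a degree-one `𝔭 ∋ p`, the
newform, an embedding datum inducing `𝔭`) and every BDP frame `(Ω_K, Ω_p, L)`: for some `k`,
`p^k · L ∈ Ch_Λ(X_ac^∅(E[p^∞]))·R₀⟦T⟧` ("`(L_𝔭(f)) ⊆ char_Λ(X_𝔭)Λ_{R₀}`" up to a `p`-power). PRINT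
(route R-β, NOT assembled in print at a reducible `p ‖ N`): the reducible Heegner-point Kolyvagin
system at `p ‖ N` — CGLS 2022 Thm. 4.1.1 (Howard 2004 with `E(K)[p] = 0`) transposed to the p-new
point with Bertolini–Darmon's regularised family (Invent. 126 (1996) §2.5 (7)–(8), Prop. 2.7;
multiplier `Φ_p = 1 − a_p⁻¹σ_𝔭`; `κ₁ ≠ 0` from Gross–Zagier in analytic rank one; cgshw MEMO-5
Add. v1.3–1.4, MEMO-6) —, the abstract Λ-adic Kolyvagin bound CGS 2025 Thm. 5.5.1 (PUB), and the
index-to-`L`-value conversion Castella arXiv:2409.01360 Cor. 2.3 (Λ⁻-adic reciprocity law,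
"Assume that E has nonsplit multiplicative reduction at p") + Prop. 3.2 (PT-equivalence) —
PREPRINT, no image hypothesis as stated. TYPED, not attempted; nothing asserted; consumed as a
hypothesis. [claim: Castella2024, status: under-review]
[cite: CastellaGrossiSkinner2025, Thm. 5.5.1 (shape only; nothing asserted)]
[cite: CastellaGrossiLeeSkinner2022, Thm. 4.1.1 and Rem. 4.1.2 (shape only; nothing asserted)]
[cite: BertoliniDarmon1996, §2.5 (7)–(8) and Prop. 2.7 (pp. 434–435)] -/
@[conjecture]
def NonsplitKolyvaginDivOnTree : Prop :=
  ∀ (N : ℕ) [NeZero N] (K : Type) [Field K] [NumberField K] (Dt : ModularParametrizationData W N)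
    (H : HeegnerDatum N (NumberField.discr K)) (ιK : K →+* ℂ) (P : (W.baseChange K).toAffine.Point),
    CellC W p → ¬ W.HasSplitMultiplicativeReductionAtPrime p → W.conductorNorm ℤ = N →
    IsImaginaryQuadratic K → NumberField.discr K < -4 → SatisfiesHeegnerHypothesis N K →
    (W.quadraticTwist (NumberField.discr K : ℚ)).entireLFunction 1 ≠ 0 →
    WeierstrassCurve.Affine.Point.map ιK.toRatAlgHom P = heegnerPointComplex Dt H →
    ¬ (p : ℤ) ∣ Dt.c → ¬ IsOfFinAddOrder P →
    ∀ (κ : ZpExtension K p), κ.IsAnticyclotomic →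
      ∀ (γ : Field.absoluteGaloisGroup K) [Fact (κ.IsTopGenerator γ)]
        (𝔭 : HeightOneSpectrum (𝓞 K)), ((p : ℕ) : 𝓞 K) ∈ 𝔭.asIdeal →
        𝔭.asIdeal.ramificationIdx (𝓞 ℚ) = 1 → 𝔭.asIdeal.inertiaDeg (𝓞 ℚ) = 1 →
        ∀ (f : CuspForm (CongruenceSubgroup.Gamma0 N) 2), IsNewformOf W f →
          ∀ (ι' : PadicAlgCl p ≃+* ℂ),
            (∀ (w : InfinitePlace K) (k : 𝓞 K),
              k ∈ 𝔭.asIdeal ↔ ‖ι'.symm (w.embedding (k : K))‖ < 1) →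
            ∀ (ΩK : ℂ) (Ωp : (unrIntegers p)ˣ) (L : UnrSeries p), ΩK ≠ 0 →
              IsBDPLFunction ι' 𝔭 κ γ f ΩK ((Ωp : unrIntegers p) : ℂ_[p]) L →
                ∃ k : ℕ, PowerSeries.C ((p : unrIntegers p) ^ k) * L ∈
                  (XAc.charIdeal (W.baseChange K) p κ 𝔭 ∅ γ).map (PowerSeries.map (toUnr p))

/-- **c3-μλ — KELLER–YIN D′: `μ = 0` AND `λ`-EQUALITY at a NON-split Eisenstein `p ‖ N`**, on the same
data and every frame `L`, for every generator `𝓕` of `Ch_Λ(X_ac^∅(E[p^∞]))`: the first unit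
coefficient of `𝓕` (read in `R₀ ⊇ ℤ_p`) and that of `L` sit at the SAME index `n` — i.e.
`μ(𝓕) = 0 = μ(L)` and `λ(𝓕) = n = λ(L)` (Weierstrass preparation over `ℤ_p` and over `R₀ = W(𝔽̄_p)`;
Washington §7.1 / §13.2). PRINT: Keller–Yin arXiv:2402.12781v2 Thm. 5.1.3 (= Thm. D), whose TEXT
proves exactly this (D′: torsion, `μ(𝔛_f) = μ(𝓛_f) = 0`, `λ(𝔛_f) = λ(𝓛_f)` — Kolyvagin-free:
specialisation of the two-variable Eisenstein congruences at the p-new weight-2 point, Hsieh/Hida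
`μ = 0`; bsd-eis-ky MEMO-2 §3 P1–P6, referee PASS) but NOT the characteristic-ideal equality it
states (free-part gap at L1754–1755, `X2/KellerYinFreePartGap.lean`). UNREFEREED PREPRINT; NEVER cite
this `Prop` as a theorem; consumed as a hypothesis. [claim: KellerYin2024, status: under-review]
[cite: KellerYin2024, Thm. 5.1.3 = Thm. D (arXiv:2402.12781v2 §5.1), the part D′ of its proof]
[cite: Washington1997, §7.1 Prop. 7.2 and §13.2 (μ, λ as first unit coefficient)] -/
@[conjecture]
def NonsplitMuLambdaOnTree : Prop :=
  ∀ (N : ℕ) [NeZero N] (K : Type) [Field K] [NumberField K] (Dt : ModularParametrizationData W N)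
    (H : HeegnerDatum N (NumberField.discr K)) (ιK : K →+* ℂ) (P : (W.baseChange K).toAffine.Point),
    CellC W p → ¬ W.HasSplitMultiplicativeReductionAtPrime p → W.conductorNorm ℤ = N →
    IsImaginaryQuadratic K → NumberField.discr K < -4 → SatisfiesHeegnerHypothesis N K →
    (W.quadraticTwist (NumberField.discr K : ℚ)).entireLFunction 1 ≠ 0 →
    WeierstrassCurve.Affine.Point.map ιK.toRatAlgHom P = heegnerPointComplex Dt H →
    ¬ (p : ℤ) ∣ Dt.c → ¬ IsOfFinAddOrder P →
    ∀ (κ : ZpExtension K p), κ.IsAnticyclotomic →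
      ∀ (γ : Field.absoluteGaloisGroup K) [Fact (κ.IsTopGenerator γ)]
        (𝔭 : HeightOneSpectrum (𝓞 K)), ((p : ℕ) : 𝓞 K) ∈ 𝔭.asIdeal →
        𝔭.asIdeal.ramificationIdx (𝓞 ℚ) = 1 → 𝔭.asIdeal.inertiaDeg (𝓞 ℚ) = 1 →
        ∀ (f : CuspForm (CongruenceSubgroup.Gamma0 N) 2), IsNewformOf W f →
          ∀ (ι' : PadicAlgCl p ≃+* ℂ),
            (∀ (w : InfinitePlace K) (k : 𝓞 K),
              k ∈ 𝔭.asIdeal ↔ ‖ι'.symm (w.embedding (k : K))‖ < 1) →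
            ∀ (ΩK : ℂ) (Ωp : (unrIntegers p)ˣ) (L : UnrSeries p), ΩK ≠ 0 →
              IsBDPLFunction ι' 𝔭 κ γ f ΩK ((Ωp : unrIntegers p) : ℂ_[p]) L →
                ∀ F : IwasawaAlgebra p,
                  XAc.charIdeal (W.baseChange K) p κ 𝔭 ∅ γ = Ideal.span {F} →
                  ∃ n : ℕ,
                    (‖((PowerSeries.coeff n (PowerSeries.map (toUnr p) F) : unrIntegers p) : ℂ_[p])‖ = 1 ∧
                      ∀ i < n, ‖((PowerSeries.coeff i (PowerSeries.map (toUnr p) F) :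
                        unrIntegers p) : ℂ_[p])‖ < 1) ∧
                    (‖((PowerSeries.coeff n L : unrIntegers p) : ℂ_[p])‖ = 1 ∧
                      ∀ i < n, ‖((PowerSeries.coeff i L : unrIntegers p) : ℂ_[p])‖ < 1)

variable {W p} in
omit [W.IsElliptic] [W.IsGloballyMinimal] in
/-- **H3 from its two halves, in the kernel: ONE DIVISIBILITY (c3-div, R-β) + `μ = 0` and `λ`-EQUALITY
(c3-μλ, KY D′) ⟹ `Ch_Λ(X_ac^∅)·R₀⟦T⟧ = (L)` (`NonsplitIMCEqOnTree W p`)** — cgshw MEMO-5 Add. v1.2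
item 2 ("Equality ⟸ 1. + KY's D′: `(𝓛_f) ⊆ char(𝔛_f)Λ^ur` and equal λ, μ force equality of
principal ideals"), via the sister seat's `R₀⟦T⟧` algebra `span_singleton_eq_of_C_pow_mul_mem`
(p406792) and the principality of characteristic ideals (`charIdeal_isPrincipal_holds`). CONDITIONAL
on the two typed halves; nothing booked. [cite: KellerYin2024, proof of Thm. 3.0.8 (the same algebra, TeX L1631–L1640)]
[cite: Washington1997, §7.1 Prop. 7.2] -/
theorem nonsplitIMCEqOnTree_of_div_of_muLambda (hdiv : NonsplitKolyvaginDivOnTree W p)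
    (hml : NonsplitMuLambdaOnTree W p) : NonsplitIMCEqOnTree W p := by
  intro N _ K _ _ Dt H ιK P hc hns hN hK hd4 hHN hLt hP hcM hPinf κ hκ γ _ 𝔭 h𝔭 he hf f hfW ι' hι'
    ΩK Ωp L hΩK hL
  obtain ⟨k, hk⟩ := hdiv N K Dt H ιK P hc hns hN hK hd4 hHN hLt hP hcM hPinf κ hκ γ 𝔭 h𝔭 he hf f
    hfW ι' hι' ΩK Ωp L hΩK hL
  obtain ⟨F, hF⟩ :=
    (charIdeal_isPrincipal_holds p (XAc (W.baseChange K) p κ 𝔭 ∅ γ)).principal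
  have hchar : XAc.charIdeal (W.baseChange K) p κ 𝔭 ∅ γ = Ideal.span {F} := hF
  obtain ⟨n, hFn, hLn⟩ := hml N K Dt H ιK P hc hns hN hK hd4 hHN hLt hP hcM hPinf κ hκ γ 𝔭 h𝔭 he
    hf f hfW ι' hι' ΩK Ωp L hΩK hL F hchar
  unfold R1.IMCEqOnTreeAt
  rw [hchar, Ideal.map_span, Set.image_singleton] at hk ⊢
  exact span_singleton_eq_of_C_pow_mul_mem hk hFn hLn

end Halves

end Summit.BirchSwinnertonDyer.Rank1Residual.X2

end
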